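import Literature.Probability.LatticeModels.LatticeGreenPoisson
import Literature.MathematicalPhysics.QuantumFieldTheory.CubicalCochains
import HarnessLib

/-!
# Interior regularity of lattice-harmonic functions, file 1/3: the objects (Green kernel `G/2`, ramp and product cut-offs,
# their lattice differences, sup-boxes, the representation kernel `K₁`)

Helper file (`--supports stmt-QuantumFields-19609`).  The only file of the series declaring definitions (plumbing objects of the
proof, no route content); files 2/3 and 3/3 are theorems only.

WHY (crux `BulkDominatesColdBoxW`, stmt-QuantumFields-19609, open stubs L1a/L1b; seat `ym-spine-20043-p1` g2 re-targeted by director-ym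
LINE №76/№78 to the BACKGROUND piece of L1b `stub_goodBoundaryMeanSmooth`).  L1b compares the box-kernel means of the plaquette cost at
the centre `p` and at `p + T e₀` (depth `H = ⌈β^θ⌉`, `T = ⌈β^A⌉ ≪ H`) uniformly over crude-good boundary data; the leading (classical)
contribution is `c_{p'}(Ū) − c_p(Ū)` for the minimal-action background `Ū` extending the datum, of size `2 sup|F̄| · T · sup|∇F̄|`, so the
estimate rests on the INTERIOR GRADIENT BOUND `|∇F̄| ≲ sup|F̄| / H`.  Each component of the linearised curvature is LATTICE-HARMONIC in
the interior (`Δ_Hodge = −Δ` componentwise on `ℤ⁴`); the scalar input is the classical interior difference estimate for harmonic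
functions (Lawler 1991 Thm. 1.7.1 (a); Lawler–Limic 2010 Thm. 6.3.8), proved in this three-file series
(`…HarmonicInteriorDefs` → `…HarmonicInteriorKernel` → `…HarmonicInteriorGradient`) from the tree's Green-function bounds.

This file (general `d`):
* `gHalf = G/2` (the Green function of `−Δ`: `Δ gHalf = −δ₀` by the tree's `latticeLaplacianZd_half_latticeGreen`);
* the 1-D ramp profile `ramp r` (`= 1` on `|t| ≤ r`, `= 0` on `|t| ≥ 2r`, linear between): `(1/r)`-Lipschitz, second differences vanish
  off the four kinks `|t| ∈ {r, 2r}` and are `≤ 2/r`;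
* the sup-boxes `sbox R` (`#sbox R = (2R+1)^d`), the product cut-off `cutoff r z = Π_k ramp r (z_k)` and its one-direction differences
  `dminus`/`dplus`/`dtwo` (`≤ 1/r`, `≤ 2/r`; vanishing deep inside, off the box of radius `2r`, and — `dtwo` — off the kink hyperplanes);
* the kernel `kernel₁ r x z = Σ_i [gHalf(x−z−eᵢ)·dplus − gHalf(x−z+eᵢ)·dminus]` of the representation proved in file 2/3.

No sorry, standard axioms.  NOT a claim about the mass gap.

References: G. F. Lawler, V. Limic, *Random Walk: A Modern Introduction* (2010) Thm. 6.3.8 (the estimate this series proves).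
-/

set_option autoImplicit false

noncomputable section

open Finset Filter Topology
open Literature.Probability.LatticeModels
open Literature.MathematicalPhysics.QuantumFieldTheory.LatticeForm (e)

namespace Summit.QuantumFields.YangMills.Theorems.WeakCouplingRates.HarmonicInterior

variable {d : ℕ}

/-! ## The Green kernel `G/2` -/

/-- `g = G/2`, the Green function of `−Δ` on `ℤ^d` (`d ≥ 3`): `Δ g = −δ₀`. -/
def gHalf (z : Site d) : ℝ := latticeGreen z / 2

/-! ## §2 The ramp cut-off -/

/-- The 1-D ramp profile: `1` on `|t| ≤ r`, `0` on `|t| ≥ 2r`, linear in between. -/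
def ramp (r : ℕ) (t : ℤ) : ℝ := min 1 (max 0 ((2 * (r : ℝ) - |(t : ℝ)|) / r))

/-- The ramp is non-negative. [folklore] -/
theorem ramp_nonneg (r : ℕ) (t : ℤ) : 0 ≤ ramp r t :=
  le_min zero_le_one (le_max_left _ _)

/-- The ramp is at most `1`. [folklore] -/
theorem ramp_le_one (r : ℕ) (t : ℤ) : ramp r t ≤ 1 := min_le_left _ _

/-- The ramp has absolute value at most `1`. [folklore] -/
theorem abs_ramp_le_one (r : ℕ) (t : ℤ) : |ramp r t| ≤ 1 := by
  rw [abs_of_nonneg (ramp_nonneg r t)]; exact ramp_le_one r t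

/-- The ramp equals `1` on `|t| ≤ r` (`r ≥ 1`). [folklore] -/
theorem ramp_eq_one {r : ℕ} (hr : 0 < r) {t : ℤ} (ht : |t| ≤ r) : ramp r t = 1 := by
  have hr' : (0 : ℝ) < r := by exact_mod_cast hr
  have ht' : |(t : ℝ)| ≤ r := by exact_mod_cast ht
  have h1 : 1 ≤ (2 * (r : ℝ) - |(t : ℝ)|) / r := by
    rw [le_div_iff₀ hr']; linarith
  unfold ramp
  rw [min_eq_left]
  exact le_trans h1 (le_max_right _ _)

/-- The ramp vanishes on `|t| ≥ 2r`. [folklore] -/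
theorem ramp_eq_zero {r : ℕ} {t : ℤ} (ht : 2 * (r : ℤ) ≤ |t|) : ramp r t = 0 := by
  have ht' : 2 * (r : ℝ) ≤ |(t : ℝ)| := by exact_mod_cast ht
  unfold ramp
  rcases Nat.eq_zero_or_pos r with hr | hr
  · subst hr; simp
  · have hr' : (0 : ℝ) < r := by exact_mod_cast hr
    have h1 : (2 * (r : ℝ) - |(t : ℝ)|) / r ≤ 0 := div_nonpos_of_nonpos_of_nonneg (by linarith) hr'.le
    rw [max_eq_left h1, min_eq_right zero_le_one]

/-- On the band `r ≤ |t| ≤ 2r` the ramp is the linear function `(2r − |t|)/r`. [folklore] -/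
theorem ramp_eq_div {r : ℕ} (hr : 0 < r) {t : ℤ} (h1 : (r : ℤ) ≤ |t|) (h2 : |t| ≤ 2 * (r : ℤ)) :
    ramp r t = (2 * (r : ℝ) - |(t : ℝ)|) / r := by
  have hr' : (0 : ℝ) < r := by exact_mod_cast hr
  have h1' : (r : ℝ) ≤ |(t : ℝ)| := by exact_mod_cast h1
  have h2' : |(t : ℝ)| ≤ 2 * (r : ℝ) := by exact_mod_cast h2
  have hle : (2 * (r : ℝ) - |(t : ℝ)|) / r ≤ 1 := by rw [div_le_iff₀ hr']; linarith
  have hge : 0 ≤ (2 * (r : ℝ) - |(t : ℝ)|) / r := div_nonneg (by linarith) hr'.le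
  unfold ramp
  rw [max_eq_right hge, min_eq_right hle]

/-- The ramp is `(1/r)`-Lipschitz. [folklore] -/
theorem abs_ramp_succ_sub_le {r : ℕ} (hr : 0 < r) (t : ℤ) : |ramp r (t + 1) - ramp r t| ≤ 1 / r := by
  have hr' : (0 : ℝ) < r := by exact_mod_cast hr
  unfold ramp
  have h1 := abs_min_sub_min_le_max (1 : ℝ) (max 0 ((2 * (r : ℝ) - |((t + 1 : ℤ) : ℝ)|) / r)) 1
    (max 0 ((2 * (r : ℝ) - |(t : ℝ)|) / r))
  have h2 := abs_max_sub_max_le_max (0 : ℝ) ((2 * (r : ℝ) - |((t + 1 : ℤ) : ℝ)|) / r) 0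
    ((2 * (r : ℝ) - |(t : ℝ)|) / r)
  have h3 : |(2 * (r : ℝ) - |((t + 1 : ℤ) : ℝ)|) / r - (2 * (r : ℝ) - |(t : ℝ)|) / r| ≤ 1 / r := by
    have e : (2 * (r : ℝ) - |((t + 1 : ℤ) : ℝ)|) / r - (2 * (r : ℝ) - |(t : ℝ)|) / r =
        (|(t : ℝ)| - |(t : ℝ) + 1|) / r := by
      push_cast; ring
    rw [e, abs_div, abs_of_pos hr']
    refine div_le_div_of_nonneg_right ?_ hr'.le
    have := abs_abs_sub_abs_le_abs_sub (t : ℝ) ((t : ℝ) + 1)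
    simpa using this
  simp only [sub_self, abs_zero] at h1 h2
  calc _ ≤ max 0 |max 0 ((2 * (r : ℝ) - |((t + 1 : ℤ) : ℝ)|) / r) - max 0 ((2 * (r : ℝ) - |(t : ℝ)|) / r)| := h1
    _ = |max 0 ((2 * (r : ℝ) - |((t + 1 : ℤ) : ℝ)|) / r) - max 0 ((2 * (r : ℝ) - |(t : ℝ)|) / r)| :=
        max_eq_right (abs_nonneg _)
    _ ≤ max 0 |(2 * (r : ℝ) - |((t + 1 : ℤ) : ℝ)|) / r - (2 * (r : ℝ) - |(t : ℝ)|) / r| := h2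
    _ = |(2 * (r : ℝ) - |((t + 1 : ℤ) : ℝ)|) / r - (2 * (r : ℝ) - |(t : ℝ)|) / r| := max_eq_right (abs_nonneg _)
    _ ≤ 1 / r := h3

/-- Away from the four kinks `|t| ∈ {r, 2r}` the ramp has vanishing second difference (`r ≥ 1`). [folklore] -/
theorem ramp_second_diff_eq_zero {r : ℕ} (hr : 0 < r) {t : ℤ} (h1 : |t| ≠ r) (h2 : |t| ≠ 2 * (r : ℤ)) :
    ramp r (t + 1) - 2 * ramp r t + ramp r (t - 1) = 0 := by
  rcases lt_or_gt_of_ne h1 with hlt | hgt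
  · -- all three equal `1`
    have hlt' := abs_lt.1 hlt
    have ha : |t + 1| ≤ r := abs_le.2 ⟨by omega, by omega⟩
    have hb : |t - 1| ≤ r := abs_le.2 ⟨by omega, by omega⟩
    rw [ramp_eq_one hr hlt.le, ramp_eq_one hr ha, ramp_eq_one hr hb]; ring
  · rcases lt_or_gt_of_ne h2 with hlt2 | hgt2
    · -- linear band: `r < |t| < 2r`, so `t ≠ 0` and `|t ± 1| = |t| ± 1` with the sign of `t`
      have e0 := ramp_eq_div hr hgt.le hlt2.le
      rcases le_or_gt 0 t with ht0 | ht0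
      · have hlt2' := abs_lt.1 hlt2
        have ht : (r : ℤ) < t := by rw [abs_of_nonneg ht0] at hgt; exact hgt
        have e1 : ramp r (t + 1) = (2 * (r : ℝ) - |((t + 1 : ℤ) : ℝ)|) / r :=
          ramp_eq_div hr (le_abs.2 (Or.inl (by omega))) (abs_le.2 ⟨by omega, by omega⟩)
        have e2 : ramp r (t - 1) = (2 * (r : ℝ) - |((t - 1 : ℤ) : ℝ)|) / r :=
          ramp_eq_div hr (le_abs.2 (Or.inl (by omega))) (abs_le.2 ⟨by omega, by omega⟩)
        rw [e0, e1, e2]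
        have h4 : (2 : ℝ) ≤ t := by exact_mod_cast (show (2 : ℤ) ≤ t by omega)
        push_cast
        rw [abs_of_nonneg (by linarith), abs_of_nonneg (by linarith), abs_of_nonneg (by linarith)]
        field_simp; ring
      · have hlt2' := abs_lt.1 hlt2
        have ht : t < -(r : ℤ) := by rw [abs_of_neg ht0] at hgt; omega
        have e1 : ramp r (t + 1) = (2 * (r : ℝ) - |((t + 1 : ℤ) : ℝ)|) / r :=
          ramp_eq_div hr (le_abs.2 (Or.inr (by omega))) (abs_le.2 ⟨by omega, by omega⟩)
        have e2 : ramp r (t - 1) = (2 * (r : ℝ) - |((t - 1 : ℤ) : ℝ)|) / r :=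
          ramp_eq_div hr (le_abs.2 (Or.inr (by omega))) (abs_le.2 ⟨by omega, by omega⟩)
        rw [e0, e1, e2]
        have h4 : (t : ℝ) ≤ -2 := by exact_mod_cast (show t ≤ -2 by omega)
        push_cast
        rw [abs_of_neg (by linarith), abs_of_neg (by linarith), abs_of_neg (by linarith)]
        field_simp; ring
    · -- all three vanish
      have hgt2' := lt_abs.1 hgt2
      have ha : 2 * (r : ℤ) ≤ |t + 1| := le_abs.2 (by omega)
      have hb : 2 * (r : ℤ) ≤ |t - 1| := le_abs.2 (by omega)
      rw [ramp_eq_zero hgt2.le, ramp_eq_zero ha, ramp_eq_zero hb]; ring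

/-- The second difference of the ramp is at most `2/r`. [folklore] -/
theorem abs_ramp_second_diff_le {r : ℕ} (hr : 0 < r) (t : ℤ) :
    |ramp r (t + 1) - 2 * ramp r t + ramp r (t - 1)| ≤ 2 / r := by
  have h1 := abs_ramp_succ_sub_le hr t
  have h2 := abs_ramp_succ_sub_le hr (t - 1)
  rw [sub_add_cancel] at h2
  calc |ramp r (t + 1) - 2 * ramp r t + ramp r (t - 1)|
      = |(ramp r (t + 1) - ramp r t) - (ramp r t - ramp r (t - 1))| := by ring_nf
    _ ≤ |ramp r (t + 1) - ramp r t| + |ramp r t - ramp r (t - 1)| := abs_sub _ _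
    _ ≤ 1 / r + 1 / r := add_le_add h1 h2
    _ = 2 / r := by ring


/-! ## §3 The product cut-off on `ℤ^d`, sup-boxes, and the kernel representation -/

/-- `eᵢ = Pi.single i 1` (the tree's `LatticeForm.e` is an abbreviation). -/
theorem e_def (i : Fin d) : (e i : Site d) = Pi.single i 1 := rfl

/-- Coordinate `i` of `z + eᵢ`. [folklore] -/
theorem add_e_apply_same (z : Site d) (i : Fin d) : (z + e i) i = z i + 1 := by simp

/-- Coordinates `k ≠ i` of `z + eᵢ`. [folklore] -/
theorem add_e_apply_ne (z : Site d) {i k : Fin d} (h : k ≠ i) : (z + e i) k = z k := by simp [h]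

/-- Coordinate `i` of `z − eᵢ`. [folklore] -/
theorem sub_e_apply_same (z : Site d) (i : Fin d) : (z - e i) i = z i - 1 := by simp [e_def]

/-- Coordinates `k ≠ i` of `z − eᵢ`. [folklore] -/
theorem sub_e_apply_ne (z : Site d) {i k : Fin d} (h : k ≠ i) : (z - e i) k = z k := by simp [e_def, h]

/-- The sup-box of radius `R` about the origin: all coordinates in `[-R, R]`. -/
def sbox (R : ℕ) : Finset (Site d) := Fintype.piFinset fun _ => Finset.Icc (-(R : ℤ)) R

/-- Membership in the sup-box. [folklore] -/
theorem mem_sbox {R : ℕ} {z : Site d} : z ∈ sbox R ↔ ∀ k, |z k| ≤ R := by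
  simp only [sbox, Fintype.mem_piFinset, Finset.mem_Icc, abs_le]

/-- Non-membership in the sup-box: some coordinate exceeds `R`. [folklore] -/
theorem not_mem_sbox {R : ℕ} {z : Site d} : z ∉ sbox R ↔ ∃ k, (R : ℤ) < |z k| := by
  simp only [mem_sbox, not_forall, not_le]

/-- The sup-box of radius `R` has `(2R+1)^d` sites. [folklore] -/
theorem card_sbox (R : ℕ) : #(sbox (d := d) R) = (2 * R + 1) ^ d := by
  rw [sbox, Fintype.card_piFinset, Finset.prod_const, Finset.card_univ, Fintype.card_fin, Int.card_Icc]
  congr 1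
  omega

/-- The product cut-off `χ_r(z) = Π_k ramp_r(z_k)`. -/
def cutoff (r : ℕ) (z : Site d) : ℝ := ∏ k, ramp r (z k)

/-- The cut-off is non-negative. [folklore] -/
theorem cutoff_nonneg (r : ℕ) (z : Site d) : 0 ≤ cutoff r z :=
  Finset.prod_nonneg fun k _ => ramp_nonneg r (z k)

/-- The cut-off is at most `1`. [folklore] -/
theorem cutoff_le_one (r : ℕ) (z : Site d) : cutoff r z ≤ 1 :=
  Finset.prod_le_one (fun k _ => ramp_nonneg r (z k)) fun k _ => ramp_le_one r (z k)

/-- The cut-off equals `1` on the sup-box of radius `r`. [folklore] -/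
theorem cutoff_eq_one {r : ℕ} (hr : 0 < r) {z : Site d} (hz : ∀ k, |z k| ≤ r) : cutoff r z = 1 :=
  Finset.prod_eq_one fun k _ => ramp_eq_one hr (hz k)

/-- The cut-off vanishes as soon as one coordinate is `≥ 2r` in absolute value. [folklore] -/
theorem cutoff_eq_zero {r : ℕ} {z : Site d} {k : Fin d} (hk : 2 * (r : ℤ) ≤ |z k|) : cutoff r z = 0 :=
  Finset.prod_eq_zero (Finset.mem_univ k) (ramp_eq_zero hk)

/-- Where the cut-off is non-zero, every coordinate is `< 2r` in absolute value. [folklore] -/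
theorem forall_abs_lt_of_cutoff_ne_zero {r : ℕ} {z : Site d} (h : cutoff r z ≠ 0) (k : Fin d) :
    |z k| < 2 * (r : ℤ) := by
  by_contra hk
  exact h (cutoff_eq_zero (k := k) (not_lt.1 hk))

/-- Singling out one coordinate. -/
theorem cutoff_eq_mul (r : ℕ) (z : Site d) (i : Fin d) :
    cutoff r z = ramp r (z i) * ∏ k ∈ Finset.univ.erase i, ramp r (z k) :=
  (Finset.mul_prod_erase Finset.univ (fun k => ramp r (z k)) (Finset.mem_univ i)).symm

/-- The product of the ramps over the coordinates `k ≠ i` is non-negative. [folklore] -/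
theorem prod_erase_nonneg (r : ℕ) (z : Site d) (i : Fin d) : 0 ≤ ∏ k ∈ Finset.univ.erase i, ramp r (z k) :=
  Finset.prod_nonneg fun k _ => ramp_nonneg r (z k)

/-- The product of the ramps over the coordinates `k ≠ i` is at most `1`. [folklore] -/
theorem prod_erase_le_one (r : ℕ) (z : Site d) (i : Fin d) : ∏ k ∈ Finset.univ.erase i, ramp r (z k) ≤ 1 :=
  Finset.prod_le_one (fun k _ => ramp_nonneg r (z k)) fun k _ => ramp_le_one r (z k)

/-- The product of the ramps over the coordinates `k ≠ i` has absolute value at most `1`. [folklore] -/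
theorem abs_prod_erase_le_one (r : ℕ) (z : Site d) (i : Fin d) : |∏ k ∈ Finset.univ.erase i, ramp r (z k)| ≤ 1 := by
  rw [abs_of_nonneg (prod_erase_nonneg r z i)]; exact prod_erase_le_one r z i

/-- The ramps in the coordinates `k ≠ i` do not see a shift by `eᵢ`. [folklore] -/
theorem prod_erase_add_e (r : ℕ) (z : Site d) (i : Fin d) :
    ∏ k ∈ Finset.univ.erase i, ramp r ((z + e i) k) = ∏ k ∈ Finset.univ.erase i, ramp r (z k) := by
  refine Finset.prod_congr rfl fun k hk => ?_
  rw [add_e_apply_ne z (Finset.mem_erase.1 hk).1]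

/-- The ramps in the coordinates `k ≠ i` do not see a shift by `−eᵢ`. [folklore] -/
theorem prod_erase_sub_e (r : ℕ) (z : Site d) (i : Fin d) :
    ∏ k ∈ Finset.univ.erase i, ramp r ((z - e i) k) = ∏ k ∈ Finset.univ.erase i, ramp r (z k) := by
  refine Finset.prod_congr rfl fun k hk => ?_
  rw [sub_e_apply_ne z (Finset.mem_erase.1 hk).1]

/-- The backward difference `χ(z) − χ(z − eᵢ)`. -/
def dminus (r : ℕ) (i : Fin d) (z : Site d) : ℝ := cutoff r z - cutoff r (z - e i)

/-- The forward difference `χ(z + eᵢ) − χ(z)`. -/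
def dplus (r : ℕ) (i : Fin d) (z : Site d) : ℝ := cutoff r (z + e i) - cutoff r z

/-- The second difference `χ(z + eᵢ) − 2χ(z) + χ(z − eᵢ)`. -/
def dtwo (r : ℕ) (i : Fin d) (z : Site d) : ℝ := cutoff r (z + e i) - 2 * cutoff r z + cutoff r (z - e i)

/-- `dtwo = dplus − dminus`. [folklore] -/
theorem dtwo_eq (r : ℕ) (i : Fin d) (z : Site d) : dtwo r i z = dplus r i z - dminus r i z := by
  unfold dtwo dplus dminus; ring

/-- `dplus` at `z − eᵢ` is `dminus` at `z`. [folklore] -/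
theorem dplus_sub_e (r : ℕ) (i : Fin d) (z : Site d) : dplus r i (z - e i) = dminus r i z := by
  unfold dplus dminus; rw [sub_add_cancel]

/-- `dminus` at `z + eᵢ` is `dplus` at `z`. [folklore] -/
theorem dminus_add_e (r : ℕ) (i : Fin d) (z : Site d) : dminus r i (z + e i) = dplus r i z := by
  unfold dplus dminus; rw [add_sub_cancel_right]

/-- Factorised form of `dminus`. [folklore] -/
theorem dminus_eq (r : ℕ) (i : Fin d) (z : Site d) :
    dminus r i z = (ramp r (z i) - ramp r (z i - 1)) * ∏ k ∈ Finset.univ.erase i, ramp r (z k) := by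
  unfold dminus
  rw [cutoff_eq_mul r z i, cutoff_eq_mul r (z - e i) i, prod_erase_sub_e, sub_e_apply_same]
  ring

/-- Factorised form of `dplus`. [folklore] -/
theorem dplus_eq (r : ℕ) (i : Fin d) (z : Site d) :
    dplus r i z = (ramp r (z i + 1) - ramp r (z i)) * ∏ k ∈ Finset.univ.erase i, ramp r (z k) := by
  unfold dplus
  rw [cutoff_eq_mul r z i, cutoff_eq_mul r (z + e i) i, prod_erase_add_e, add_e_apply_same]
  ring

/-- Factorised form of `dtwo`. [folklore] -/
theorem dtwo_eq' (r : ℕ) (i : Fin d) (z : Site d) :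
    dtwo r i z = (ramp r (z i + 1) - 2 * ramp r (z i) + ramp r (z i - 1)) * ∏ k ∈ Finset.univ.erase i, ramp r (z k) := by
  rw [dtwo_eq, dplus_eq, dminus_eq]; ring

/-- `|dminus| ≤ 1/r`. [folklore] -/
theorem abs_dminus_le {r : ℕ} (hr : 0 < r) (i : Fin d) (z : Site d) : |dminus r i z| ≤ 1 / r := by
  rw [dminus_eq, abs_mul]
  have h1 : |ramp r (z i) - ramp r (z i - 1)| ≤ 1 / r := by
    have := abs_ramp_succ_sub_le hr (z i - 1)
    rwa [sub_add_cancel] at this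
  calc |ramp r (z i) - ramp r (z i - 1)| * |∏ k ∈ Finset.univ.erase i, ramp r (z k)| ≤ (1 / r : ℝ) * 1 :=
        mul_le_mul h1 (abs_prod_erase_le_one r z i) (abs_nonneg _) (by positivity)
    _ = 1 / r := mul_one _

/-- `|dplus| ≤ 1/r`. [folklore] -/
theorem abs_dplus_le {r : ℕ} (hr : 0 < r) (i : Fin d) (z : Site d) : |dplus r i z| ≤ 1 / r := by
  rw [← dminus_add_e]; exact abs_dminus_le hr i _

/-- `|dtwo| ≤ 2/r`. [folklore] -/
theorem abs_dtwo_le {r : ℕ} (hr : 0 < r) (i : Fin d) (z : Site d) : |dtwo r i z| ≤ 2 / r := by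
  rw [dtwo_eq', abs_mul]
  calc |ramp r (z i + 1) - 2 * ramp r (z i) + ramp r (z i - 1)| * |∏ k ∈ Finset.univ.erase i, ramp r (z k)|
      ≤ (2 / r : ℝ) * 1 :=
        mul_le_mul (abs_ramp_second_diff_le hr (z i)) (abs_prod_erase_le_one r z i) (abs_nonneg _) (by positivity)
    _ = 2 / r := mul_one _

/-- Deep inside (`|z_i| + 1 ≤ r`) the backward difference vanishes. -/
theorem dminus_eq_zero {r : ℕ} (hr : 0 < r) {i : Fin d} {z : Site d} (hz : |z i| + 1 ≤ r) : dminus r i z = 0 := by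
  have h := abs_le.1 (show |z i| ≤ (r : ℤ) - 1 by omega)
  rw [dminus_eq, ramp_eq_one hr (abs_le.2 ⟨by omega, by omega⟩), ramp_eq_one hr (abs_le.2 ⟨by omega, by omega⟩)]
  ring

/-- Deep inside the second difference vanishes. -/
theorem dtwo_eq_zero_of_deep {r : ℕ} (hr : 0 < r) {i : Fin d} {z : Site d} (hz : |z i| + 1 ≤ r) : dtwo r i z = 0 := by
  rw [dtwo_eq', ramp_second_diff_eq_zero hr (by omega) (by omega), zero_mul]

/-- Off the four kink hyperplanes `|z_i| ∈ {r, 2r}` the second difference vanishes. -/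
theorem dtwo_eq_zero {r : ℕ} (hr : 0 < r) {i : Fin d} {z : Site d} (h1 : |z i| ≠ r) (h2 : |z i| ≠ 2 * (r : ℤ)) :
    dtwo r i z = 0 := by
  rw [dtwo_eq', ramp_second_diff_eq_zero hr h1 h2, zero_mul]

/-- `dminus r i` vanishes off the sup-box of radius `2r`. -/
theorem dminus_eq_zero_of_not_mem {r : ℕ} {i : Fin d} {z : Site d} (hz : z ∉ sbox (2 * r)) : dminus r i z = 0 := by
  obtain ⟨k, hk⟩ := not_mem_sbox.1 hz
  push_cast at hk
  have hk' := lt_abs.1 hk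
  unfold dminus
  have h1 : cutoff r z = 0 := cutoff_eq_zero (k := k) hk.le
  have h2 : cutoff r (z - e i) = 0 := by
    refine cutoff_eq_zero (k := k) ?_
    by_cases hki : k = i
    · subst hki; rw [sub_e_apply_same]; exact le_abs.2 (by omega)
    · rw [sub_e_apply_ne z hki]; exact hk.le
  rw [h1, h2, sub_zero]

/-- `dplus r i` vanishes off the sup-box of radius `2r`. -/
theorem dplus_eq_zero_of_not_mem {r : ℕ} {i : Fin d} {z : Site d} (hz : z ∉ sbox (2 * r)) : dplus r i z = 0 := by
  obtain ⟨k, hk⟩ := not_mem_sbox.1 hz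
  push_cast at hk
  have hk' := lt_abs.1 hk
  unfold dplus
  have h1 : cutoff r z = 0 := cutoff_eq_zero (k := k) hk.le
  have h2 : cutoff r (z + e i) = 0 := by
    refine cutoff_eq_zero (k := k) ?_
    by_cases hki : k = i
    · subst hki; rw [add_e_apply_same]; exact le_abs.2 (by omega)
    · rw [add_e_apply_ne z hki]; exact hk.le
  rw [h1, h2, sub_zero]

/-- `dtwo r i` vanishes off the sup-box of radius `2r`. -/
theorem dtwo_eq_zero_of_not_mem {r : ℕ} {i : Fin d} {z : Site d} (hz : z ∉ sbox (2 * r)) : dtwo r i z = 0 := by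
  rw [dtwo_eq, dplus_eq_zero_of_not_mem hz, dminus_eq_zero_of_not_mem hz, sub_zero]

/-- The kernel `K₁(x, z) = Σ_i [g(x−z−eᵢ)·(χ(z+eᵢ) − χ(z)) − g(x−z+eᵢ)·(χ(z) − χ(z−eᵢ))]`. -/
def kernel₁ (r : ℕ) (x z : Site d) : ℝ :=
  ∑ i, (gHalf (x - z - e i) * dplus r i z - gHalf (x - z + e i) * dminus r i z)

end Summit.QuantumFields.YangMills.Theorems.WeakCouplingRates.HarmonicInterior

end
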